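import Mathlib.Tactic.Ring
import Mathlib.Tactic.Linarith
import Mathlib.Tactic.Positivity
import Mathlib.Tactic.LinearCombination
import Mathlib.Tactic.FieldSimp
import Mathlib.Data.Real.Basic
import HarnessLib

/-!
# Conjecture N (hodge-weil ladder, GAPS G51b/G51c), format (5,3): the KEY CHARGE LEMMA of the doubly-one-sided class

Prover 2, generation 16 (note `run/shared/lean/b2b/hodge-weil/b2b-hweil-pv2-g16/DOS-G16.md` §2). Setting of `CONJECTURE-N.md` §1 in
format (5,3); this file concerns the CHARGES only. For E-charges `u_e` and F-charges `v₁ ≤ v₂ ≤ v₃` with `v₁ ≤ u_e ≤ v₃` put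
`b_e := u_e − v₁ ≥ 0`, `c_e := v₃ − u_e = δ − b_e ≥ 0`, `δ := v₃ − v₁ > 0`, `x := v₂ − v₁ ∈ [0, δ]`. Centring + (P4) say that the
second divided difference of `g ↦ K₀(g) = ∏_e(u_e − v_g)` over the three F-charges vanishes (Leibniz form `DD2 = 0`, proved from the
purity sums in `WeilClassTestFormatFiveThreeDoublyOneSidedAllTilts.lean`). Here:
* `key_identity` — `C₀(δ−x)³ + C₁x(δ−x)² + C₂x²(δ−x) + C₃x³ = δ⁵·DD2` with `C₀ = 4∏b + Σ_e c_e b_{∖e} − ∏c`,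
  `C₁ = 6∏b − Σ_{e<f} c_ec_f b_{∖ef} − 4∏c`, `C₂ = 4∏b + Σ_{e<f<g} c_ec_fc_g b_{∖efg} − 6∏c`, `C₃ = ∏b − Σ_e b_e c_{∖e} − 4∏c`
  (in the ratios `r_e = c_e/b_e`: `C_i = ∏b·c_i(r)`, `c₀ = 4 + e₁ − e₅`, `c₁ = 6 − e₂ − 4e₅`, `c₂ = 4 + e₃ − 6e₅`, `c₃ = 1 − e₄ − 4e₅`);
* `coeffs_pos` — `r_e ≥ 0`, `Σr_e < 5/2` ⟹ all four `c_i(r) > 0` (AM–GM for four and five variables, `e₂ ≤ e₁²/2`);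
* **`key`** — `DD2 = 0` ⟹ `15·∏_e b_e ≤ 2δ·e₄(b)`, i.e. `Σ_e δ/b_e ≥ 15/2` whenever `∏b > 0` (numerically the infimum is `8.03`):
  the y⁰-purity constraint keeps the E-charges away from the top F-charge. This is the input of the mid-tilt case of
  `conjectureN_53_doublyOneSided` (LEMMA DOS of pv2-g15's note, ADDENDUM 1).
Pure algebra; nothing here is a case of HC, a rung or a door edge; no statement of Markman's papers is used. New cell result ⇒ Summits/.
-/

set_option linter.dupNamespace false

namespace Summit.HodgeConjecture.HodgeConjecture.WeilClassTestFormatFiveThreeDoublyOneSidedKey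

/-- AM–GM for two reals: `ab ≤ ((a+b)/2)²`. -/
theorem amgm2 (a b : ℝ) : a * b ≤ ((a + b) / 2) ^ 2 := by
  nlinarith [sq_nonneg (a - b)]

/-- AM–GM for four nonnegative reals: `abcd ≤ ((a+b+c+d)/4)⁴`. -/
theorem amgm4 (a b c d : ℝ) (ha : 0 ≤ a) (hb : 0 ≤ b) (hc : 0 ≤ c) (hd : 0 ≤ d) :
    a * b * c * d ≤ ((a + b + c + d) / 4) ^ 4 := by
  have h1 : a * b ≤ ((a + b) / 2) ^ 2 := amgm2 a b
  have h2 : c * d ≤ ((c + d) / 2) ^ 2 := amgm2 c d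
  have hcd : 0 ≤ c * d := mul_nonneg hc hd
  have h3 : a * b * (c * d) ≤ ((a + b) / 2) ^ 2 * ((c + d) / 2) ^ 2 :=
    mul_le_mul h1 h2 hcd (by positivity)
  have h4 : ((a + b) / 2) * ((c + d) / 2) ≤ (((a + b) / 2 + (c + d) / 2) / 2) ^ 2 := amgm2 _ _
  have h5 : 0 ≤ ((a + b) / 2) * ((c + d) / 2) := by positivity
  have h6 : (((a + b) / 2) * ((c + d) / 2)) ^ 2 ≤ ((((a + b) / 2 + (c + d) / 2) / 2) ^ 2) ^ 2 :=
    pow_le_pow_left₀ h5 h4 2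
  calc a * b * c * d = a * b * (c * d) := by ring
    _ ≤ ((a + b) / 2) ^ 2 * ((c + d) / 2) ^ 2 := h3
    _ = (((a + b) / 2) * ((c + d) / 2)) ^ 2 := by ring
    _ ≤ ((((a + b) / 2 + (c + d) / 2) / 2) ^ 2) ^ 2 := h6
    _ = ((a + b + c + d) / 4) ^ 4 := by ring

/-- Weighted AM–GM with weights `4 : 1` in polynomial form: `3125·a⁴b ≤ (4a+b)⁵` for `a, b ≥ 0`, because
`(4a+b)⁵ − 3125a⁴b = (b−a)²(b³ + 22ab² + 203a²b + 1024a³)`. -/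
theorem amgm41 (a b : ℝ) (ha : 0 ≤ a) (hb : 0 ≤ b) : 3125 * a ^ 4 * b ≤ (4 * a + b) ^ 5 := by
  have e : (4 * a + b) ^ 5 - 3125 * a ^ 4 * b
      = (b - a) ^ 2 * (b ^ 3 + 22 * a * b ^ 2 + 203 * a ^ 2 * b + 1024 * a ^ 3) := by ring
  have : 0 ≤ (b - a) ^ 2 * (b ^ 3 + 22 * a * b ^ 2 + 203 * a ^ 2 * b + 1024 * a ^ 3) := by positivity
  linarith

/-- AM–GM for five nonnegative reals: `r₁r₂r₃r₄r₅ ≤ ((r₁+r₂+r₃+r₄+r₅)/5)⁵` (from `amgm4` and `amgm41`). -/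
theorem amgm5 (r₁ r₂ r₃ r₄ r₅ : ℝ) (h₁ : 0 ≤ r₁) (h₂ : 0 ≤ r₂) (h₃ : 0 ≤ r₃) (h₄ : 0 ≤ r₄) (h₅ : 0 ≤ r₅) :
    r₁ * r₂ * r₃ * r₄ * r₅ ≤ ((r₁ + r₂ + r₃ + r₄ + r₅) / 5) ^ 5 := by
  have hm0 : 0 ≤ (r₁ + r₂ + r₃ + r₄) / 4 := by positivity
  have h4 : r₁ * r₂ * r₃ * r₄ ≤ ((r₁ + r₂ + r₃ + r₄) / 4) ^ 4 := amgm4 r₁ r₂ r₃ r₄ h₁ h₂ h₃ h₄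
  have h5 : r₁ * r₂ * r₃ * r₄ * r₅ ≤ ((r₁ + r₂ + r₃ + r₄) / 4) ^ 4 * r₅ := mul_le_mul_of_nonneg_right h4 h₅
  have h6 : 3125 * ((r₁ + r₂ + r₃ + r₄) / 4) ^ 4 * r₅ ≤ (4 * ((r₁ + r₂ + r₃ + r₄) / 4) + r₅) ^ 5 :=
    amgm41 _ r₅ hm0 h₅
  have h7 : (4 * ((r₁ + r₂ + r₃ + r₄) / 4) + r₅) ^ 5 = 3125 * ((r₁ + r₂ + r₃ + r₄ + r₅) / 5) ^ 5 := by ring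
  rw [h7] at h6
  linarith

/-- The four coefficients `c₀ = 4 + e₁ − e₅`, `c₁ = 6 − e₂ − 4e₅`, `c₂ = 4 + e₃ − 6e₅`, `c₃ = 1 − e₄ − 4e₅` of the elementary
symmetric functions of five nonnegative reals with `e₁ < 5/2` are all positive (`e₅ ≤ (e₁/5)⁵ ≤ 1/32`, `e₄ ≤ 5(e₁/4)⁴ ≤ 3125/4096`,
`e₂ ≤ e₁²/2 ≤ 25/8`). -/
theorem coeffs_pos (r₁ r₂ r₃ r₄ r₅ : ℝ) (h₁ : 0 ≤ r₁) (h₂ : 0 ≤ r₂) (h₃ : 0 ≤ r₃) (h₄ : 0 ≤ r₄) (h₅ : 0 ≤ r₅)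
    (hs : r₁ + r₂ + r₃ + r₄ + r₅ < 5 / 2) :
    0 < 4 + (r₁ + r₂ + r₃ + r₄ + r₅) - r₁ * r₂ * r₃ * r₄ * r₅
    ∧ 0 < 6 - (r₁ * r₂ + r₁ * r₃ + r₁ * r₄ + r₁ * r₅ + r₂ * r₃ + r₂ * r₄ + r₂ * r₅ + r₃ * r₄ + r₃ * r₅ + r₄ * r₅)
          - 4 * (r₁ * r₂ * r₃ * r₄ * r₅)
    ∧ 0 < 4 + (r₁ * r₂ * r₃ + r₁ * r₂ * r₄ + r₁ * r₂ * r₅ + r₁ * r₃ * r₄ + r₁ * r₃ * r₅ + r₁ * r₄ * r₅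
          + r₂ * r₃ * r₄ + r₂ * r₃ * r₅ + r₂ * r₄ * r₅ + r₃ * r₄ * r₅) - 6 * (r₁ * r₂ * r₃ * r₄ * r₅)
    ∧ 0 < 1 - (r₂ * r₃ * r₄ * r₅ + r₁ * r₃ * r₄ * r₅ + r₁ * r₂ * r₄ * r₅ + r₁ * r₂ * r₃ * r₅ + r₁ * r₂ * r₃ * r₄)
          - 4 * (r₁ * r₂ * r₃ * r₄ * r₅) := by
  have hs0 : 0 ≤ r₁ + r₂ + r₃ + r₄ + r₅ := by positivity
  have hs' : r₁ + r₂ + r₃ + r₄ + r₅ ≤ 5 / 2 := hs.le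
  -- e₅ ≤ (s/5)⁵ ≤ (1/2)⁵
  have he5a := amgm5 r₁ r₂ r₃ r₄ r₅ h₁ h₂ h₃ h₄ h₅
  have he5b : ((r₁ + r₂ + r₃ + r₄ + r₅) / 5) ^ 5 ≤ (1 / 2 : ℝ) ^ 5 :=
    pow_le_pow_left₀ (by positivity) (by linarith) 5
  have he5 : r₁ * r₂ * r₃ * r₄ * r₅ ≤ 1 / 32 := by
    have : (1 / 2 : ℝ) ^ 5 = 1 / 32 := by norm_num
    linarith
  -- each 4-product ≤ ((s − r_a)/4)⁴ ≤ (s/4)⁴ ≤ (5/8)⁴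
  have hq : ((r₁ + r₂ + r₃ + r₄ + r₅) / 4) ^ 4 ≤ (5 / 8 : ℝ) ^ 4 :=
    pow_le_pow_left₀ (by positivity) (by linarith) 4
  have hq' : (5 / 8 : ℝ) ^ 4 = 625 / 4096 := by norm_num
  have hA1 : r₂ * r₃ * r₄ * r₅ ≤ 625 / 4096 := by
    have a := amgm4 r₂ r₃ r₄ r₅ h₂ h₃ h₄ h₅
    have b : ((r₂ + r₃ + r₄ + r₅) / 4) ^ 4 ≤ ((r₁ + r₂ + r₃ + r₄ + r₅) / 4) ^ 4 :=
      pow_le_pow_left₀ (by positivity) (by linarith) 4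
    linarith
  have hA2 : r₁ * r₃ * r₄ * r₅ ≤ 625 / 4096 := by
    have a := amgm4 r₁ r₃ r₄ r₅ h₁ h₃ h₄ h₅
    have b : ((r₁ + r₃ + r₄ + r₅) / 4) ^ 4 ≤ ((r₁ + r₂ + r₃ + r₄ + r₅) / 4) ^ 4 :=
      pow_le_pow_left₀ (by positivity) (by linarith) 4
    linarith
  have hA3 : r₁ * r₂ * r₄ * r₅ ≤ 625 / 4096 := by
    have a := amgm4 r₁ r₂ r₄ r₅ h₁ h₂ h₄ h₅
    have b : ((r₁ + r₂ + r₄ + r₅) / 4) ^ 4 ≤ ((r₁ + r₂ + r₃ + r₄ + r₅) / 4) ^ 4 :=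
      pow_le_pow_left₀ (by positivity) (by linarith) 4
    linarith
  have hA4 : r₁ * r₂ * r₃ * r₅ ≤ 625 / 4096 := by
    have a := amgm4 r₁ r₂ r₃ r₅ h₁ h₂ h₃ h₅
    have b : ((r₁ + r₂ + r₃ + r₅) / 4) ^ 4 ≤ ((r₁ + r₂ + r₃ + r₄ + r₅) / 4) ^ 4 :=
      pow_le_pow_left₀ (by positivity) (by linarith) 4
    linarith
  have hA5 : r₁ * r₂ * r₃ * r₄ ≤ 625 / 4096 := by
    have a := amgm4 r₁ r₂ r₃ r₄ h₁ h₂ h₃ h₄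
    have b : ((r₁ + r₂ + r₃ + r₄) / 4) ^ 4 ≤ ((r₁ + r₂ + r₃ + r₄ + r₅) / 4) ^ 4 :=
      pow_le_pow_left₀ (by positivity) (by linarith) 4
    linarith
  -- e₂ ≤ s²/2 ≤ 25/8
  have he2 : r₁ * r₂ + r₁ * r₃ + r₁ * r₄ + r₁ * r₅ + r₂ * r₃ + r₂ * r₄ + r₂ * r₅ + r₃ * r₄ + r₃ * r₅ + r₄ * r₅ ≤ 25 / 8 := by
    have e : (r₁ + r₂ + r₃ + r₄ + r₅) ^ 2 = (r₁ ^ 2 + r₂ ^ 2 + r₃ ^ 2 + r₄ ^ 2 + r₅ ^ 2)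
        + 2 * (r₁ * r₂ + r₁ * r₃ + r₁ * r₄ + r₁ * r₅ + r₂ * r₃ + r₂ * r₄ + r₂ * r₅ + r₃ * r₄ + r₃ * r₅ + r₄ * r₅) := by ring
    have sq : (r₁ + r₂ + r₃ + r₄ + r₅) ^ 2 ≤ (5 / 2 : ℝ) ^ 2 := pow_le_pow_left₀ hs0 hs' 2
    have p : 0 ≤ r₁ ^ 2 + r₂ ^ 2 + r₃ ^ 2 + r₄ ^ 2 + r₅ ^ 2 := by positivity
    have n : (5 / 2 : ℝ) ^ 2 = 25 / 4 := by norm_num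
    linarith
  have he3 : 0 ≤ r₁ * r₂ * r₃ + r₁ * r₂ * r₄ + r₁ * r₂ * r₅ + r₁ * r₃ * r₄ + r₁ * r₃ * r₅ + r₁ * r₄ * r₅
          + r₂ * r₃ * r₄ + r₂ * r₃ * r₅ + r₂ * r₄ * r₅ + r₃ * r₄ * r₅ := by positivity
  refine ⟨by linarith, by linarith, by linarith, by linarith⟩

/-- THE IDENTITY behind `key`: with `c_e = δ − b_e` and the F-charges at `0, x, δ` (relative to `v₁`),
`C₀(δ−x)³ + C₁x(δ−x)² + C₂x²(δ−x) + C₃x³ = δ⁵·DD2`, where `DD2` is the Leibniz form of the second divided difference of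
`g ↦ ∏_e(u_e − v_g)` over the nodes `v₁, v₂, v₃` (ten products of three factors). -/
theorem key_identity (b₁ b₂ b₃ b₄ b₅ δ x : ℝ) :
    (4 * (b₁ * b₂ * b₃ * b₄ * b₅)
        + ((δ - b₁) * (b₂ * b₃ * b₄ * b₅) + (δ - b₂) * (b₁ * b₃ * b₄ * b₅) + (δ - b₃) * (b₁ * b₂ * b₄ * b₅)
          + (δ - b₄) * (b₁ * b₂ * b₃ * b₅) + (δ - b₅) * (b₁ * b₂ * b₃ * b₄))
        - (δ - b₁) * (δ - b₂) * (δ - b₃) * (δ - b₄) * (δ - b₅)) * (δ - x) ^ 3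
      + (6 * (b₁ * b₂ * b₃ * b₄ * b₅)
        - ((δ - b₁) * (δ - b₂) * (b₃ * b₄ * b₅) + (δ - b₁) * (δ - b₃) * (b₂ * b₄ * b₅) + (δ - b₁) * (δ - b₄) * (b₂ * b₃ * b₅)
          + (δ - b₁) * (δ - b₅) * (b₂ * b₃ * b₄) + (δ - b₂) * (δ - b₃) * (b₁ * b₄ * b₅) + (δ - b₂) * (δ - b₄) * (b₁ * b₃ * b₅)
          + (δ - b₂) * (δ - b₅) * (b₁ * b₃ * b₄) + (δ - b₃) * (δ - b₄) * (b₁ * b₂ * b₅) + (δ - b₃) * (δ - b₅) * (b₁ * b₂ * b₄)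
          + (δ - b₄) * (δ - b₅) * (b₁ * b₂ * b₃))
        - 4 * ((δ - b₁) * (δ - b₂) * (δ - b₃) * (δ - b₄) * (δ - b₅))) * x * (δ - x) ^ 2
      + (4 * (b₁ * b₂ * b₃ * b₄ * b₅)
        + ((δ - b₃) * (δ - b₄) * (δ - b₅) * (b₁ * b₂) + (δ - b₂) * (δ - b₄) * (δ - b₅) * (b₁ * b₃)
          + (δ - b₂) * (δ - b₃) * (δ - b₅) * (b₁ * b₄) + (δ - b₂) * (δ - b₃) * (δ - b₄) * (b₁ * b₅)
          + (δ - b₁) * (δ - b₄) * (δ - b₅) * (b₂ * b₃) + (δ - b₁) * (δ - b₃) * (δ - b₅) * (b₂ * b₄)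
          + (δ - b₁) * (δ - b₃) * (δ - b₄) * (b₂ * b₅) + (δ - b₁) * (δ - b₂) * (δ - b₅) * (b₃ * b₄)
          + (δ - b₁) * (δ - b₂) * (δ - b₄) * (b₃ * b₅) + (δ - b₁) * (δ - b₂) * (δ - b₃) * (b₄ * b₅))
        - 6 * ((δ - b₁) * (δ - b₂) * (δ - b₃) * (δ - b₄) * (δ - b₅))) * x ^ 2 * (δ - x)
      + ((b₁ * b₂ * b₃ * b₄ * b₅)
        - (b₁ * ((δ - b₂) * (δ - b₃) * (δ - b₄) * (δ - b₅)) + b₂ * ((δ - b₁) * (δ - b₃) * (δ - b₄) * (δ - b₅))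
          + b₃ * ((δ - b₁) * (δ - b₂) * (δ - b₄) * (δ - b₅)) + b₄ * ((δ - b₁) * (δ - b₂) * (δ - b₃) * (δ - b₅))
          + b₅ * ((δ - b₁) * (δ - b₂) * (δ - b₃) * (δ - b₄)))
        - 4 * ((δ - b₁) * (δ - b₂) * (δ - b₃) * (δ - b₄) * (δ - b₅))) * x ^ 3
    = δ ^ 5 * ((b₃ - δ) * (b₄ - δ) * (b₅ - δ)
        + (b₂ - x) * (b₄ - δ) * (b₅ - δ)
        + (b₂ - x) * (b₃ - x) * (b₅ - δ)
        + (b₂ - x) * (b₃ - x) * (b₄ - x)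
        + b₁ * (b₄ - δ) * (b₅ - δ)
        + b₁ * (b₃ - x) * (b₅ - δ)
        + b₁ * (b₃ - x) * (b₄ - x)
        + b₁ * b₂ * (b₅ - δ)
        + b₁ * b₂ * (b₄ - x)
        + b₁ * b₂ * b₃) := by
  ring

/-- **KEY CHARGE LEMMA.** For `0 ≤ b_e ≤ δ`, `0 ≤ x ≤ δ`, `δ > 0` and the second-divided-difference constraint `DD2 = 0`
(centring + P4 in the doubly-one-sided class, F-charges `v₁ ≤ v₂ ≤ v₃`, `b_e = u_e − v₁`, `x = v₂ − v₁`, `δ = v₃ − v₁`):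
`15·∏_e b_e ≤ 2δ·e₄(b)` — i.e. `Σ_e δ/b_e ≥ 15/2` when all `b_e > 0`. -/
theorem key (b₁ b₂ b₃ b₄ b₅ δ x : ℝ)
    (hb₁ : 0 ≤ b₁) (hb₂ : 0 ≤ b₂) (hb₃ : 0 ≤ b₃) (hb₄ : 0 ≤ b₄) (hb₅ : 0 ≤ b₅)
    (hc₁ : b₁ ≤ δ) (hc₂ : b₂ ≤ δ) (hc₃ : b₃ ≤ δ) (hc₄ : b₄ ≤ δ) (hc₅ : b₅ ≤ δ)
    (hx : 0 ≤ x) (hxδ : x ≤ δ) (hδ : 0 < δ)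
    (hDD : (b₃ - δ) * (b₄ - δ) * (b₅ - δ)
        + (b₂ - x) * (b₄ - δ) * (b₅ - δ)
        + (b₂ - x) * (b₃ - x) * (b₅ - δ)
        + (b₂ - x) * (b₃ - x) * (b₄ - x)
        + b₁ * (b₄ - δ) * (b₅ - δ)
        + b₁ * (b₃ - x) * (b₅ - δ)
        + b₁ * (b₃ - x) * (b₄ - x)
        + b₁ * b₂ * (b₅ - δ)
        + b₁ * b₂ * (b₄ - x)
        + b₁ * b₂ * b₃ = 0) :
    15 * (b₁ * b₂ * b₃ * b₄ * b₅)
      ≤ 2 * δ * (b₂ * b₃ * b₄ * b₅ + b₁ * b₃ * b₄ * b₅ + b₁ * b₂ * b₄ * b₅ + b₁ * b₂ * b₃ * b₅ + b₁ * b₂ * b₃ * b₄) := by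
  by_contra hcon
  push Not at hcon
  have he4 : 0 ≤ b₂ * b₃ * b₄ * b₅ + b₁ * b₃ * b₄ * b₅ + b₁ * b₂ * b₄ * b₅ + b₁ * b₂ * b₃ * b₅ + b₁ * b₂ * b₃ * b₄ := by
    positivity
  have hP : 0 < b₁ * b₂ * b₃ * b₄ * b₅ := by nlinarith
  have hp₁ : 0 < b₁ := lt_of_le_of_ne hb₁ (by rintro h; rw [← h] at hP; simp at hP)
  have hp₂ : 0 < b₂ := lt_of_le_of_ne hb₂ (by rintro h; rw [← h] at hP; simp at hP)
  have hp₃ : 0 < b₃ := lt_of_le_of_ne hb₃ (by rintro h; rw [← h] at hP; simp at hP)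
  have hp₄ : 0 < b₄ := lt_of_le_of_ne hb₄ (by rintro h; rw [← h] at hP; simp at hP)
  have hp₅ : 0 < b₅ := lt_of_le_of_ne hb₅ (by rintro h; rw [← h] at hP; simp at hP)
  -- the ratios r_e = c_e / b_e
  obtain ⟨r₁, hr₁⟩ : ∃ r : ℝ, r = (δ - b₁) / b₁ := ⟨_, rfl⟩
  obtain ⟨r₂, hr₂⟩ : ∃ r : ℝ, r = (δ - b₂) / b₂ := ⟨_, rfl⟩
  obtain ⟨r₃, hr₃⟩ : ∃ r : ℝ, r = (δ - b₃) / b₃ := ⟨_, rfl⟩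
  obtain ⟨r₄, hr₄⟩ : ∃ r : ℝ, r = (δ - b₄) / b₄ := ⟨_, rfl⟩
  obtain ⟨r₅, hr₅⟩ : ∃ r : ℝ, r = (δ - b₅) / b₅ := ⟨_, rfl⟩
  have hne₁ : b₁ ≠ 0 := ne_of_gt hp₁
  have hne₂ : b₂ ≠ 0 := ne_of_gt hp₂
  have hne₃ : b₃ ≠ 0 := ne_of_gt hp₃
  have hne₄ : b₄ ≠ 0 := ne_of_gt hp₄
  have hne₅ : b₅ ≠ 0 := ne_of_gt hp₅
  have h₁ : 0 ≤ r₁ := by rw [hr₁]; exact div_nonneg (by linarith) hb₁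
  have h₂ : 0 ≤ r₂ := by rw [hr₂]; exact div_nonneg (by linarith) hb₂
  have h₃ : 0 ≤ r₃ := by rw [hr₃]; exact div_nonneg (by linarith) hb₃
  have h₄ : 0 ≤ r₄ := by rw [hr₄]; exact div_nonneg (by linarith) hb₄
  have h₅ : 0 ≤ r₅ := by rw [hr₅]; exact div_nonneg (by linarith) hb₅
  have k₁ : δ - b₁ = b₁ * r₁ := by rw [hr₁]; field_simp
  have k₂ : δ - b₂ = b₂ * r₂ := by rw [hr₂]; field_simp
  have k₃ : δ - b₃ = b₃ * r₃ := by rw [hr₃]; field_simp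
  have k₄ : δ - b₄ = b₄ * r₄ := by rw [hr₄]; field_simp
  have k₅ : δ - b₅ = b₅ * r₅ := by rw [hr₅]; field_simp
  -- Σ r_e < 5/2
  have hsum : (r₁ + r₂ + r₃ + r₄ + r₅) * (b₁ * b₂ * b₃ * b₄ * b₅)
      = δ * (b₂ * b₃ * b₄ * b₅ + b₁ * b₃ * b₄ * b₅ + b₁ * b₂ * b₄ * b₅ + b₁ * b₂ * b₃ * b₅ + b₁ * b₂ * b₃ * b₄)
        - 5 * (b₁ * b₂ * b₃ * b₄ * b₅) := by
    have e : (r₁ + r₂ + r₃ + r₄ + r₅) * (b₁ * b₂ * b₃ * b₄ * b₅)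
        = (b₁ * r₁) * (b₂ * b₃ * b₄ * b₅) + (b₂ * r₂) * (b₁ * b₃ * b₄ * b₅) + (b₃ * r₃) * (b₁ * b₂ * b₄ * b₅)
          + (b₄ * r₄) * (b₁ * b₂ * b₃ * b₅) + (b₅ * r₅) * (b₁ * b₂ * b₃ * b₄) := by ring
    rw [e, ← k₁, ← k₂, ← k₃, ← k₄, ← k₅]; ring
  have hs : r₁ + r₂ + r₃ + r₄ + r₅ < 5 / 2 := by
    by_contra hge
    push Not at hge
    have := mul_le_mul_of_nonneg_right hge hP.le
    linarith
  obtain ⟨c0, c1, c2, c3⟩ := coeffs_pos r₁ r₂ r₃ r₄ r₅ h₁ h₂ h₃ h₄ h₅ hs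
  -- the four coefficients of the identity are `∏b · c_i(r) > 0`
  have hC0 : 0 < 4 * (b₁ * b₂ * b₃ * b₄ * b₅)
        + ((δ - b₁) * (b₂ * b₃ * b₄ * b₅) + (δ - b₂) * (b₁ * b₃ * b₄ * b₅) + (δ - b₃) * (b₁ * b₂ * b₄ * b₅)
          + (δ - b₄) * (b₁ * b₂ * b₃ * b₅) + (δ - b₅) * (b₁ * b₂ * b₃ * b₄))
        - (δ - b₁) * (δ - b₂) * (δ - b₃) * (δ - b₄) * (δ - b₅) := by
    have e : 4 * (b₁ * b₂ * b₃ * b₄ * b₅)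
        + ((δ - b₁) * (b₂ * b₃ * b₄ * b₅) + (δ - b₂) * (b₁ * b₃ * b₄ * b₅) + (δ - b₃) * (b₁ * b₂ * b₄ * b₅)
          + (δ - b₄) * (b₁ * b₂ * b₃ * b₅) + (δ - b₅) * (b₁ * b₂ * b₃ * b₄))
        - (δ - b₁) * (δ - b₂) * (δ - b₃) * (δ - b₄) * (δ - b₅)
        = (b₁ * b₂ * b₃ * b₄ * b₅) * (4 + (r₁ + r₂ + r₃ + r₄ + r₅) - r₁ * r₂ * r₃ * r₄ * r₅) := by
      rw [k₁, k₂, k₃, k₄, k₅]; ring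
    rw [e]; exact mul_pos hP c0
  have hC1 : 0 < 6 * (b₁ * b₂ * b₃ * b₄ * b₅)
        - ((δ - b₁) * (δ - b₂) * (b₃ * b₄ * b₅) + (δ - b₁) * (δ - b₃) * (b₂ * b₄ * b₅) + (δ - b₁) * (δ - b₄) * (b₂ * b₃ * b₅)
          + (δ - b₁) * (δ - b₅) * (b₂ * b₃ * b₄) + (δ - b₂) * (δ - b₃) * (b₁ * b₄ * b₅) + (δ - b₂) * (δ - b₄) * (b₁ * b₃ * b₅)
          + (δ - b₂) * (δ - b₅) * (b₁ * b₃ * b₄) + (δ - b₃) * (δ - b₄) * (b₁ * b₂ * b₅) + (δ - b₃) * (δ - b₅) * (b₁ * b₂ * b₄)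
          + (δ - b₄) * (δ - b₅) * (b₁ * b₂ * b₃))
        - 4 * ((δ - b₁) * (δ - b₂) * (δ - b₃) * (δ - b₄) * (δ - b₅)) := by
    have e : 6 * (b₁ * b₂ * b₃ * b₄ * b₅)
        - ((δ - b₁) * (δ - b₂) * (b₃ * b₄ * b₅) + (δ - b₁) * (δ - b₃) * (b₂ * b₄ * b₅) + (δ - b₁) * (δ - b₄) * (b₂ * b₃ * b₅)
          + (δ - b₁) * (δ - b₅) * (b₂ * b₃ * b₄) + (δ - b₂) * (δ - b₃) * (b₁ * b₄ * b₅) + (δ - b₂) * (δ - b₄) * (b₁ * b₃ * b₅)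
          + (δ - b₂) * (δ - b₅) * (b₁ * b₃ * b₄) + (δ - b₃) * (δ - b₄) * (b₁ * b₂ * b₅) + (δ - b₃) * (δ - b₅) * (b₁ * b₂ * b₄)
          + (δ - b₄) * (δ - b₅) * (b₁ * b₂ * b₃))
        - 4 * ((δ - b₁) * (δ - b₂) * (δ - b₃) * (δ - b₄) * (δ - b₅))
        = (b₁ * b₂ * b₃ * b₄ * b₅) * (6 - (r₁ * r₂ + r₁ * r₃ + r₁ * r₄ + r₁ * r₅ + r₂ * r₃ + r₂ * r₄ + r₂ * r₅
            + r₃ * r₄ + r₃ * r₅ + r₄ * r₅) - 4 * (r₁ * r₂ * r₃ * r₄ * r₅)) := by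
      rw [k₁, k₂, k₃, k₄, k₅]; ring
    rw [e]; exact mul_pos hP c1
  have hC2 : 0 < 4 * (b₁ * b₂ * b₃ * b₄ * b₅)
        + ((δ - b₃) * (δ - b₄) * (δ - b₅) * (b₁ * b₂) + (δ - b₂) * (δ - b₄) * (δ - b₅) * (b₁ * b₃)
          + (δ - b₂) * (δ - b₃) * (δ - b₅) * (b₁ * b₄) + (δ - b₂) * (δ - b₃) * (δ - b₄) * (b₁ * b₅)
          + (δ - b₁) * (δ - b₄) * (δ - b₅) * (b₂ * b₃) + (δ - b₁) * (δ - b₃) * (δ - b₅) * (b₂ * b₄)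
          + (δ - b₁) * (δ - b₃) * (δ - b₄) * (b₂ * b₅) + (δ - b₁) * (δ - b₂) * (δ - b₅) * (b₃ * b₄)
          + (δ - b₁) * (δ - b₂) * (δ - b₄) * (b₃ * b₅) + (δ - b₁) * (δ - b₂) * (δ - b₃) * (b₄ * b₅))
        - 6 * ((δ - b₁) * (δ - b₂) * (δ - b₃) * (δ - b₄) * (δ - b₅)) := by
    have e : 4 * (b₁ * b₂ * b₃ * b₄ * b₅)
        + ((δ - b₃) * (δ - b₄) * (δ - b₅) * (b₁ * b₂) + (δ - b₂) * (δ - b₄) * (δ - b₅) * (b₁ * b₃)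
          + (δ - b₂) * (δ - b₃) * (δ - b₅) * (b₁ * b₄) + (δ - b₂) * (δ - b₃) * (δ - b₄) * (b₁ * b₅)
          + (δ - b₁) * (δ - b₄) * (δ - b₅) * (b₂ * b₃) + (δ - b₁) * (δ - b₃) * (δ - b₅) * (b₂ * b₄)
          + (δ - b₁) * (δ - b₃) * (δ - b₄) * (b₂ * b₅) + (δ - b₁) * (δ - b₂) * (δ - b₅) * (b₃ * b₄)
          + (δ - b₁) * (δ - b₂) * (δ - b₄) * (b₃ * b₅) + (δ - b₁) * (δ - b₂) * (δ - b₃) * (b₄ * b₅))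
        - 6 * ((δ - b₁) * (δ - b₂) * (δ - b₃) * (δ - b₄) * (δ - b₅))
        = (b₁ * b₂ * b₃ * b₄ * b₅) * (4 + (r₁ * r₂ * r₃ + r₁ * r₂ * r₄ + r₁ * r₂ * r₅ + r₁ * r₃ * r₄ + r₁ * r₃ * r₅
            + r₁ * r₄ * r₅ + r₂ * r₃ * r₄ + r₂ * r₃ * r₅ + r₂ * r₄ * r₅ + r₃ * r₄ * r₅) - 6 * (r₁ * r₂ * r₃ * r₄ * r₅)) := by
      rw [k₁, k₂, k₃, k₄, k₅]; ring
    rw [e]; exact mul_pos hP c2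
  have hC3 : 0 < (b₁ * b₂ * b₃ * b₄ * b₅)
        - (b₁ * ((δ - b₂) * (δ - b₃) * (δ - b₄) * (δ - b₅)) + b₂ * ((δ - b₁) * (δ - b₃) * (δ - b₄) * (δ - b₅))
          + b₃ * ((δ - b₁) * (δ - b₂) * (δ - b₄) * (δ - b₅)) + b₄ * ((δ - b₁) * (δ - b₂) * (δ - b₃) * (δ - b₅))
          + b₅ * ((δ - b₁) * (δ - b₂) * (δ - b₃) * (δ - b₄)))
        - 4 * ((δ - b₁) * (δ - b₂) * (δ - b₃) * (δ - b₄) * (δ - b₅)) := by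
    have e : (b₁ * b₂ * b₃ * b₄ * b₅)
        - (b₁ * ((δ - b₂) * (δ - b₃) * (δ - b₄) * (δ - b₅)) + b₂ * ((δ - b₁) * (δ - b₃) * (δ - b₄) * (δ - b₅))
          + b₃ * ((δ - b₁) * (δ - b₂) * (δ - b₄) * (δ - b₅)) + b₄ * ((δ - b₁) * (δ - b₂) * (δ - b₃) * (δ - b₅))
          + b₅ * ((δ - b₁) * (δ - b₂) * (δ - b₃) * (δ - b₄)))
        - 4 * ((δ - b₁) * (δ - b₂) * (δ - b₃) * (δ - b₄) * (δ - b₅))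
        = (b₁ * b₂ * b₃ * b₄ * b₅) * (1 - (r₂ * r₃ * r₄ * r₅ + r₁ * r₃ * r₄ * r₅ + r₁ * r₂ * r₄ * r₅ + r₁ * r₂ * r₃ * r₅
            + r₁ * r₂ * r₃ * r₄) - 4 * (r₁ * r₂ * r₃ * r₄ * r₅)) := by
      rw [k₁, k₂, k₃, k₄, k₅]; ring
    rw [e]; exact mul_pos hP c3
  -- hence the left-hand side of `key_identity` is positive, while the right-hand side vanishes
  have hid := key_identity b₁ b₂ b₃ b₄ b₅ δ x
  rw [hDD, mul_zero] at hid
  have hxb : 0 ≤ δ - x := by linarith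
  -- abbreviate the four coefficients
  generalize hA0 : (4 * (b₁ * b₂ * b₃ * b₄ * b₅)
        + ((δ - b₁) * (b₂ * b₃ * b₄ * b₅) + (δ - b₂) * (b₁ * b₃ * b₄ * b₅) + (δ - b₃) * (b₁ * b₂ * b₄ * b₅)
          + (δ - b₄) * (b₁ * b₂ * b₃ * b₅) + (δ - b₅) * (b₁ * b₂ * b₃ * b₄))
        - (δ - b₁) * (δ - b₂) * (δ - b₃) * (δ - b₄) * (δ - b₅)) = A0 at hid hC0
  generalize hA1 : (6 * (b₁ * b₂ * b₃ * b₄ * b₅)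
        - ((δ - b₁) * (δ - b₂) * (b₃ * b₄ * b₅) + (δ - b₁) * (δ - b₃) * (b₂ * b₄ * b₅) + (δ - b₁) * (δ - b₄) * (b₂ * b₃ * b₅)
          + (δ - b₁) * (δ - b₅) * (b₂ * b₃ * b₄) + (δ - b₂) * (δ - b₃) * (b₁ * b₄ * b₅) + (δ - b₂) * (δ - b₄) * (b₁ * b₃ * b₅)
          + (δ - b₂) * (δ - b₅) * (b₁ * b₃ * b₄) + (δ - b₃) * (δ - b₄) * (b₁ * b₂ * b₅) + (δ - b₃) * (δ - b₅) * (b₁ * b₂ * b₄)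
          + (δ - b₄) * (δ - b₅) * (b₁ * b₂ * b₃))
        - 4 * ((δ - b₁) * (δ - b₂) * (δ - b₃) * (δ - b₄) * (δ - b₅))) = A1 at hid hC1
  generalize hA2 : (4 * (b₁ * b₂ * b₃ * b₄ * b₅)
        + ((δ - b₃) * (δ - b₄) * (δ - b₅) * (b₁ * b₂) + (δ - b₂) * (δ - b₄) * (δ - b₅) * (b₁ * b₃)
          + (δ - b₂) * (δ - b₃) * (δ - b₅) * (b₁ * b₄) + (δ - b₂) * (δ - b₃) * (δ - b₄) * (b₁ * b₅)
          + (δ - b₁) * (δ - b₄) * (δ - b₅) * (b₂ * b₃) + (δ - b₁) * (δ - b₃) * (δ - b₅) * (b₂ * b₄)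
          + (δ - b₁) * (δ - b₃) * (δ - b₄) * (b₂ * b₅) + (δ - b₁) * (δ - b₂) * (δ - b₅) * (b₃ * b₄)
          + (δ - b₁) * (δ - b₂) * (δ - b₄) * (b₃ * b₅) + (δ - b₁) * (δ - b₂) * (δ - b₃) * (b₄ * b₅))
        - 6 * ((δ - b₁) * (δ - b₂) * (δ - b₃) * (δ - b₄) * (δ - b₅))) = A2 at hid hC2
  generalize hA3 : ((b₁ * b₂ * b₃ * b₄ * b₅)
        - (b₁ * ((δ - b₂) * (δ - b₃) * (δ - b₄) * (δ - b₅)) + b₂ * ((δ - b₁) * (δ - b₃) * (δ - b₄) * (δ - b₅))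
          + b₃ * ((δ - b₁) * (δ - b₂) * (δ - b₄) * (δ - b₅)) + b₄ * ((δ - b₁) * (δ - b₂) * (δ - b₃) * (δ - b₅))
          + b₅ * ((δ - b₁) * (δ - b₂) * (δ - b₃) * (δ - b₄)))
        - 4 * ((δ - b₁) * (δ - b₂) * (δ - b₃) * (δ - b₄) * (δ - b₅))) = A3 at hid hC3
  have t0 : 0 ≤ A0 * (δ - x) ^ 3 := mul_nonneg hC0.le (pow_nonneg hxb 3)
  have t1 : 0 ≤ A1 * x * (δ - x) ^ 2 := mul_nonneg (mul_nonneg hC1.le hx) (pow_nonneg hxb 2)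
  have t2 : 0 ≤ A2 * x ^ 2 * (δ - x) := mul_nonneg (mul_nonneg hC2.le (pow_nonneg hx 2)) hxb
  have t3 : 0 ≤ A3 * x ^ 3 := mul_nonneg hC3.le (pow_nonneg hx 3)
  have e0 : A0 * (δ - x) ^ 3 = 0 := by linarith
  have e3 : A3 * x ^ 3 = 0 := by linarith
  have f0 : (δ - x) ^ 3 = 0 := by
    rcases mul_eq_zero.mp e0 with h | h
    · linarith
    · exact h
  have f3 : x ^ 3 = 0 := by
    rcases mul_eq_zero.mp e3 with h | h
    · linarith
    · exact h
  have g0 : δ - x = 0 := pow_eq_zero_iff (n := 3) (by norm_num) |>.mp f0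
  have g3 : x = 0 := pow_eq_zero_iff (n := 3) (by norm_num) |>.mp f3
  linarith

end Summit.HodgeConjecture.HodgeConjecture.WeilClassTestFormatFiveThreeDoublyOneSidedKey
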